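import Summits.Ventures.Crystal3D.Theorems.StickyWulffConstantGenericWallFloorStackLedgerOneSidedTilt
import Summits.Ventures.Crystal3D.Theorems.StickyWulffConstantGenericWallFloorAtHalf
import HarnessLib

/-!
# `GenericWallFloor` per pair from ONE grain's walkers along a slot that is steep for a TILTED vertical:
# charge `½κ` for every slot with `e₃`-component `≥ 13/25` whose rays miss the far lattice
# (crux `GenericWallFloor`, stmt-Ventures-19480, line `WallLedgerG`)

HONEST FRAMING. Venture `Summits/Ventures/Crystal3D` (cell `crystal3d-full`), helper `--supports` the crux
`GenericWallFloor` of `route-Ventures-StickyWulffConstant`, REGISTERED line `WallLedgerG`, open stub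
`stub_twoSlabAdhesion`.  Rung credit only; F-C1 not moved; NOT the crux: the charge here is `½κ < 1` in general, and the
certified computations `ExactOnly`(C12-55) [E1] and `StarPairFar` remain inputs BY NAME.

`…AtHalf` (19480-p2 g5) turns the one-sided `e₃`-ledger into `GenericWallFloorAtCharge (½κ₁)` for `e₃`-STEEP slots.
With the tilted ledger `twoSlabAdhesion_stackLedger_oneSided_tilt` the same corollaries hold for every slot steep for
some unit `z` with `‖z − e₃‖ ≤ 1/4`:

* `exists_tilt_vertical` — every unit vector `v` with `⟪v, e₃⟫ ≥ 13/25` is steep (`⟪v, z⟫ ≥ √2/2`) for an explicit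
  vertical `z = (63/65)e₃ + (16/65)ŵ` (`ŵ` the horizontal direction of `v`) with `‖z − e₃‖ ≤ 1/4`;
* `genericWallFloorAtCharge_oneSided_tilt_of_far` / `…_chain_tilt_of_far` / `…_word_tilt_of_far` — the tilted
  analogues of `genericWallFloorAtCharge_oneSided_of_far`, `genericWallFloorAtHalf_chain_of_far` (forced-ray set
  `chainFrames z A₁ u₁` of the TILTED walk) and `genericWallFloorAtHalf_word_of_far`;
* **`genericWallFloorAtCharge_word_of_inner_ge`** — for a CHAIN pair `A₂·Λ₀ = (wordFrame A₁ κ)·Λ₀` (`|κ| ≥ 2`) and ANY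
  slot `u₁` of grain 1 lying IN the first mirror plane with `⟪A₁u₁, e₃⟫ ≥ 13/25`:
  `GenericWallFloorAtCharge (√2⟪A₁u₁, e₃⟫/2)` (`≥ 0.367`), modulo `ExactOnly`(C12-55) and `StarPairFar` — no vertical
  left in the statement.

WHY (seat census `calc/sigma9_census.py`, 3000 Haar `Σ9` pairs, reproducing 19480-p2 g5's cell table): the steepest
in-plane slot of a composition plane tilted by `θ` has `e₃`-component `≥ (√3/2) sin θ`; it is `≥ 0.52` for SOME grain in
`99 %` of the MUTUAL-ARRIVAL class (`5.4 %` of `Σ9`, where the only previous bound was `2σ²/3721`) and in `99 %` of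
the whole ray-aligned residual — there the crux's matrix now holds residual-free at `c₀ = ½κ ∈ [0.37, 0.5)`.
WHAT THIS IS NOT: not `c₀ = 1` on the core (that needs two-sided charging with riser payers); grain 2's mirror version
is not in this file; F-C1 not moved.
-/

noncomputable section

namespace Summit.Ventures.Crystal3D.Theorems

open Summit.Ventures.Crystal3D Finset
open Literature.MathematicalPhysics.StatisticalMechanics (fccStacking barlowStacking IsHaggSeq)
open scoped InnerProductSpace

/-! ### A tilted vertical for every slot of `e₃`-component `≥ 13/25` -/

/-- Decimal bounds for `√2`. -/
theorem sqrt_two_bounds : (1.41421 : ℝ) ≤ Real.sqrt 2 ∧ Real.sqrt 2 ≤ (1.41422 : ℝ) := by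
  constructor
  · rw [show (1.41421 : ℝ) = Real.sqrt (1.41421 ^ 2) by rw [Real.sqrt_sq (by norm_num)]]
    exact Real.sqrt_le_sqrt (by norm_num)
  · have h : Real.sqrt 2 ≤ Real.sqrt ((1.41422 : ℝ) ^ 2) := Real.sqrt_le_sqrt (by norm_num)
    rwa [Real.sqrt_sq (by norm_num)] at h

/-- The scalar inequality behind the tilted vertical: for `13/25 ≤ s ≤ √2/2` and `n = √(1 − s²)`,
`(63 s + 16 n)/65 ≥ √2/2`. -/
theorem tilt_scalar_ineq {s n : ℝ} (hs : (13 / 25 : ℝ) ≤ s) (hs1 : s ≤ Real.sqrt 2 / 2) (hn : 0 ≤ n)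
    (hn2 : n ^ 2 = 1 - s ^ 2) : Real.sqrt 2 / 2 ≤ 63 / 65 * s + 16 / 65 * n := by
  obtain ⟨ht, ht'⟩ := sqrt_two_bounds
  have hsq2 : Real.sqrt 2 ^ 2 = 2 := Real.sq_sqrt (by norm_num)
  have hs0 : 0 ≤ s := by linarith
  -- `4225 s² − 4095 √2 s + 1856.5 ≤ 0` on the interval
  have hprod : 0 ≤ (s - 13 / 25) * (Real.sqrt 2 / 2 - s) := mul_nonneg (by linarith) (by linarith)
  have hlin : 4095 * Real.sqrt 2 * s ≥ 4095 * 1.41421 * s := by nlinarith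
  have key : 4225 * s ^ 2 - 4095 * Real.sqrt 2 * s + 3713 / 2 ≤ 0 := by nlinarith
  by_contra hlt
  push Not at hlt
  have h1 : 16 * n < 65 * Real.sqrt 2 / 2 - 63 * s := by linarith
  have h2 : 0 ≤ 16 * n := by positivity
  have h3 := mul_self_lt_mul_self h2 h1
  have h4 : 16 * n * (16 * n) = 256 * (1 - s ^ 2) := by rw [← hn2]; ring
  rw [h4] at h3
  nlinarith [h3, key, hsq2]

/-- **A tilted vertical.**  Every unit vector `v` with `⟪v, e₃⟫ ≥ 13/25` is steep (`⟪v, z⟫ ≥ √2/2`) for some unit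
`z` with `‖z − e₃‖ ≤ 1/4` (if `v` is not already `e₃`-steep: `z = (63/65)e₃ + (16/65)ŵ`, `ŵ` the unit horizontal part
of `v`). -/
theorem exists_tilt_vertical {v : EuclideanSpace ℝ (Fin 3)} (hv : ‖v‖ = 1)
    (hs : (13 / 25 : ℝ) ≤ ⟪v, EuclideanSpace.single (2 : Fin 3) (1 : ℝ)⟫_ℝ) :
    ∃ z : EuclideanSpace ℝ (Fin 3), ‖z‖ = 1 ∧ ‖z - EuclideanSpace.single (2 : Fin 3) (1 : ℝ)‖ ≤ 1 / 4 ∧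
      Real.sqrt 2 / 2 ≤ ⟪v, z⟫_ℝ := by
  by_cases hst : Real.sqrt 2 / 2 ≤ ⟪v, EuclideanSpace.single (2 : Fin 3) (1 : ℝ)⟫_ℝ
  · refine ⟨EuclideanSpace.single (2 : Fin 3) (1 : ℝ), by rw [PiLp.norm_single, norm_one], ?_, hst⟩
    rw [sub_self, norm_zero]; norm_num
  push Not at hst
  obtain ⟨e, he⟩ : ∃ e : EuclideanSpace ℝ (Fin 3), e = EuclideanSpace.single (2 : Fin 3) (1 : ℝ) := ⟨_, rfl⟩
  rw [← he] at hs hst ⊢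
  have hen : ‖e‖ = 1 := by rw [he, PiLp.norm_single, norm_one]
  obtain ⟨s, hsdef⟩ : ∃ s : ℝ, s = ⟪v, e⟫_ℝ := ⟨_, rfl⟩
  rw [← hsdef] at hs hst
  have hee : ⟪e, e⟫_ℝ = 1 := by rw [real_inner_self_eq_norm_sq, hen]; norm_num
  have hs0 : 0 ≤ s := by linarith
  have hs1 : s ≤ Real.sqrt 2 / 2 := hst.le
  have hsq2 : Real.sqrt 2 ^ 2 = 2 := Real.sq_sqrt (by norm_num)
  -- the horizontal part of `v`
  obtain ⟨w₀, hw₀⟩ : ∃ w₀ : EuclideanSpace ℝ (Fin 3), w₀ = v - s • e := ⟨_, rfl⟩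
  have hw₀e : ⟪w₀, e⟫_ℝ = 0 := by
    rw [hw₀, inner_sub_left, real_inner_smul_left, hee, hsdef]; ring
  have hew₀ : ⟪e, w₀⟫_ℝ = 0 := by rw [real_inner_comm]; exact hw₀e
  have hvw₀ : ⟪v, w₀⟫_ℝ = 1 - s ^ 2 := by
    rw [hw₀, inner_sub_right, real_inner_smul_right, real_inner_self_eq_norm_sq, hv, ← hsdef]; ring
  have hw₀sq : ‖w₀‖ ^ 2 = 1 - s ^ 2 := by
    rw [← real_inner_self_eq_norm_sq]
    have : ⟪w₀, w₀⟫_ℝ = ⟪v, w₀⟫_ℝ - s * ⟪e, w₀⟫_ℝ := by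
      have e1 : ⟪w₀, w₀⟫_ℝ = ⟪v - s • e, w₀⟫_ℝ := by rw [← hw₀]
      rw [e1, inner_sub_left, real_inner_smul_left]
    rw [this, hvw₀, hew₀]; ring
  obtain ⟨n, hndef⟩ : ∃ n : ℝ, n = ‖w₀‖ := ⟨_, rfl⟩
  rw [← hndef] at hw₀sq
  have hn0 : 0 ≤ n := by rw [hndef]; exact norm_nonneg _
  have hnpos : 0 < n := by
    have h1 : 0 < n ^ 2 := by rw [hw₀sq]; nlinarith
    rcases hn0.lt_or_eq with h | h
    · exact h
    · rw [← h] at h1; norm_num at h1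
  have hn1 : n ≠ 0 := hnpos.ne'
  -- the unit horizontal direction
  obtain ⟨w, hwdef⟩ : ∃ w : EuclideanSpace ℝ (Fin 3), w = n⁻¹ • w₀ := ⟨_, rfl⟩
  have hwe : ⟪w, e⟫_ℝ = 0 := by rw [hwdef, real_inner_smul_left, hw₀e, mul_zero]
  have hew : ⟪e, w⟫_ℝ = 0 := by rw [real_inner_comm]; exact hwe
  have hw₀w₀ : ⟪w₀, w₀⟫_ℝ = n ^ 2 := by rw [real_inner_self_eq_norm_sq, hndef]
  have hww : ⟪w, w⟫_ℝ = 1 := by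
    rw [hwdef, real_inner_smul_left, real_inner_smul_right, hw₀w₀]
    field_simp
  have hvw : ⟪v, w⟫_ℝ = n := by
    rw [hwdef, real_inner_smul_right, hvw₀, ← hw₀sq]
    field_simp
  -- the tilted vertical
  obtain ⟨z, hzdef⟩ : ∃ z : EuclideanSpace ℝ (Fin 3), z = (63 / 65 : ℝ) • e + (16 / 65 : ℝ) • w := ⟨_, rfl⟩
  have hzz : ⟪z, z⟫_ℝ = 1 := by
    rw [hzdef]
    simp only [inner_add_left, inner_add_right, real_inner_smul_left, real_inner_smul_right, hee, hww, hwe, hew]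
    norm_num
  have hz1 : ‖z‖ = 1 := by
    have h := real_inner_self_eq_norm_sq z
    rw [hzz] at h
    nlinarith [norm_nonneg z]
  have hze : ‖z - e‖ ≤ 1 / 4 := by
    have h1 : z - e = (-(2 / 65) : ℝ) • e + (16 / 65 : ℝ) • w := by rw [hzdef]; module
    have h2 : ⟪z - e, z - e⟫_ℝ = 4 / 65 := by
      rw [h1]
      simp only [inner_add_left, inner_add_right, real_inner_smul_left, real_inner_smul_right, hee, hww, hwe, hew]
      norm_num
    have h3 := real_inner_self_eq_norm_sq (z - e)
    rw [h2] at h3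
    nlinarith [norm_nonneg (z - e)]
  have hvz : ⟪v, z⟫_ℝ = 63 / 65 * s + 16 / 65 * n := by
    rw [hzdef, inner_add_right, real_inner_smul_right, real_inner_smul_right, hvw, ← hsdef]
  refine ⟨z, hz1, hze, ?_⟩
  rw [hvz]
  exact tilt_scalar_ineq hs hs1 hn0 hw₀sq

/-! ### Grain 1 alone, tilted vertical -/

open scoped Classical in
/-- **`GenericWallFloor` per pair at charge `½κ₁` from grain 1 alone, tilted vertical**, modulo `ExactOnly`(C12-55)
and `StarPairFar`: unit `z` with `‖z − e₃‖ ≤ 1/4`, slot `u₁` steep for `z`, every frame of every sound well-formed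
`z`-stack over `(A₁, u₁, 0)` lies in `M₁`, and no frame of `M₁` has `A₂`'s lattice. -/
theorem genericWallFloorAtCharge_oneSided_tilt_of_far
    {s₀ : EuclideanSpace ℝ (Fin 3)} (hs₀ : s₀ ∈ fccSlots)
    (hcert : ExactOnly 0 (fccSlots.filter fun w => 0 < ⟪w, s₀⟫_ℝ)) (hfar : StarPairFar)
    (A₁ : EuclideanSpace ℝ (Fin 3) ≃ₗᵢ[ℝ] EuclideanSpace ℝ (Fin 3)) (t₁ : EuclideanSpace ℝ (Fin 3))
    (A₂ : EuclideanSpace ℝ (Fin 3) ≃ₗᵢ[ℝ] EuclideanSpace ℝ (Fin 3)) (t₂ : EuclideanSpace ℝ (Fin 3))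
    {z : EuclideanSpace ℝ (Fin 3)} (hz : ‖z‖ = 1) (hze : ‖z - EuclideanSpace.single (2 : Fin 3) (1 : ℝ)‖ ≤ 1 / 4)
    {u₁ : EuclideanSpace ℝ (Fin 3)} (hu₁ : u₁ ∈ fccSlots) (hsteep₁ : Real.sqrt 2 / 2 ≤ ⟪A₁ u₁, z⟫_ℝ)
    (M₁ : Set (EuclideanSpace ℝ (Fin 3) ≃ₗᵢ[ℝ] EuclideanSpace ℝ (Fin 3)))
    (hM₁ : ∀ stk : List WalkEntry, StackSound z stk → StackWF z stk → stk.getLast? = some ⟨A₁, u₁, 0⟩ →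
      ∀ e ∈ stk, e.frame ∈ M₁)
    (hmiss : ∀ F ∈ M₁, F '' fccStacking 1 (Real.sqrt (2 / 3)) ≠ A₂ '' fccStacking 1 (Real.sqrt (2 / 3))) :
    GenericWallFloorAtCharge (Real.sqrt 2 * |⟪A₁ u₁, EuclideanSpace.single (2 : Fin 3) (1 : ℝ)⟫_ℝ| / 2) A₁ t₁ A₂ t₂ :=
  genericWallFloorAtCharge_of_ledger _ A₁ t₁ A₂ t₂
    (twoSlabAdhesion_stackLedger_oneSided_tilt hs₀ hcert (doubleStarCoaxialAt_of_starPairFar hfar)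
      (capPairCoaxial_of_starPairFar hfar) A₁ t₁ A₂ t₂ hz hze hu₁ hsteep₁ M₁ hM₁ hmiss)

open scoped Classical in
/-- **Charge `½κ₁` from grain 1 over the FORCED RAYS of the tilted walk**: the countable frame set `chainFrames z A₁ u₁`
(base frame and the forced rays of `u₁` for the vertical `z`) misses `A₂`'s lattice. -/
theorem genericWallFloorAtCharge_chain_tilt_of_far
    {s₀ : EuclideanSpace ℝ (Fin 3)} (hs₀ : s₀ ∈ fccSlots)
    (hcert : ExactOnly 0 (fccSlots.filter fun w => 0 < ⟪w, s₀⟫_ℝ)) (hfar : StarPairFar)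
    (A₁ : EuclideanSpace ℝ (Fin 3) ≃ₗᵢ[ℝ] EuclideanSpace ℝ (Fin 3)) (t₁ : EuclideanSpace ℝ (Fin 3))
    (A₂ : EuclideanSpace ℝ (Fin 3) ≃ₗᵢ[ℝ] EuclideanSpace ℝ (Fin 3)) (t₂ : EuclideanSpace ℝ (Fin 3))
    {z : EuclideanSpace ℝ (Fin 3)} (hz : ‖z‖ = 1) (hze : ‖z - EuclideanSpace.single (2 : Fin 3) (1 : ℝ)‖ ≤ 1 / 4)
    {u₁ : EuclideanSpace ℝ (Fin 3)} (hu₁ : u₁ ∈ fccSlots) (hsteep₁ : Real.sqrt 2 / 2 ≤ ⟪A₁ u₁, z⟫_ℝ)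
    (hmiss : ∀ F ∈ chainFrames z A₁ u₁,
      F '' fccStacking 1 (Real.sqrt (2 / 3)) ≠ A₂ '' fccStacking 1 (Real.sqrt (2 / 3))) :
    GenericWallFloorAtCharge (Real.sqrt 2 * |⟪A₁ u₁, EuclideanSpace.single (2 : Fin 3) (1 : ℝ)⟫_ℝ| / 2) A₁ t₁ A₂ t₂ :=
  genericWallFloorAtCharge_oneSided_tilt_of_far hs₀ hcert hfar A₁ t₁ A₂ t₂ hz hze hu₁ hsteep₁ _
    (fun _ hS hW hlast => frame_mem_chainFrames_of_stack hS hW hlast) hmiss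

open scoped Classical in
/-- **Charge `½κ₁` from grain 1 under the one-sided WORD CRITERION, tilted vertical**: `A₂·Λ₀ = (wordFrame A₁ κ)·Λ₀` for
a reduced model menu word `κ`, `|κ| ≥ 2`, a unit `z` with `‖z − e₃‖ ≤ 1/4`, and a slot `u₁` steep for `z` IN the first
mirror plane (`⟪u₁, μ⟫ = 0` for the last letter `μ`). -/
theorem genericWallFloorAtCharge_word_tilt_of_far
    {s₀ : EuclideanSpace ℝ (Fin 3)} (hs₀ : s₀ ∈ fccSlots)
    (hcert : ExactOnly 0 (fccSlots.filter fun w => 0 < ⟪w, s₀⟫_ℝ)) (hfar : StarPairFar)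
    (A₁ : EuclideanSpace ℝ (Fin 3) ≃ₗᵢ[ℝ] EuclideanSpace ℝ (Fin 3)) (t₁ : EuclideanSpace ℝ (Fin 3))
    (A₂ : EuclideanSpace ℝ (Fin 3) ≃ₗᵢ[ℝ] EuclideanSpace ℝ (Fin 3)) (t₂ : EuclideanSpace ℝ (Fin 3))
    {z : EuclideanSpace ℝ (Fin 3)} (hz : ‖z‖ = 1) (hze : ‖z - EuclideanSpace.single (2 : Fin 3) (1 : ℝ)‖ ≤ 1 / 4)
    {u₁ : EuclideanSpace ℝ (Fin 3)} (hu₁ : u₁ ∈ fccSlots) (hsteep₁ : Real.sqrt 2 / 2 ≤ ⟪A₁ u₁, z⟫_ℝ)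
    (κ : List (EuclideanSpace ℝ (Fin 3)))
    (hκl : ∀ μ ∈ κ, ‖μ‖ = 1 ∧
      ∀ w ∈ fccSlots, ⟪w, μ⟫_ℝ = 0 ∨ ⟪w, μ⟫_ℝ = Real.sqrt (2 / 3) ∨ ⟪w, μ⟫_ℝ = -Real.sqrt (2 / 3))
    (hκc : List.IsChain (fun μ μ' => ⟪μ, μ'⟫_ℝ = 1 / 3 ∨ ⟪μ, μ'⟫_ℝ = -1 / 3) κ) (hκ2 : 2 ≤ κ.length)
    (hA₂ : A₂ '' fccStacking 1 (Real.sqrt (2 / 3)) = (wordFrame A₁ κ) '' fccStacking 1 (Real.sqrt (2 / 3)))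
    (hfirst : ∀ μ, κ.getLast? = some μ → ⟪u₁, μ⟫_ℝ = 0) :
    GenericWallFloorAtCharge (Real.sqrt 2 * |⟪A₁ u₁, EuclideanSpace.single (2 : Fin 3) (1 : ℝ)⟫_ℝ| / 2) A₁ t₁ A₂ t₂ :=
  genericWallFloorAtCharge_oneSided_tilt_of_far hs₀ hcert hfar A₁ t₁ A₂ t₂ hz hze hu₁ hsteep₁
    {F | ∃ stk : List WalkEntry, StackSound z stk ∧ StackWF z stk ∧ stk.getLast? = some ⟨A₁, u₁, 0⟩ ∧
      ∃ e ∈ stk, e.frame = F}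
    (fun stk hS hW hlast e he => ⟨stk, hS, hW, hlast, e, he, rfl⟩)
    (fun _ ⟨_, hS, hW, hl, _, he, hF⟩ => by rw [← hF]; exact image_ne_of_word κ hκl hκc hκ2 hA₂ hfirst hS hW hl he)

open scoped Classical in
/-- **Charge `½κ₁ = (√2/2)⟪A₁u₁, e₃⟫` from grain 1 under the word criterion for EVERY in-plane slot of `e₃`-component
`≥ 13/25`** (the vertical is chosen by `exists_tilt_vertical`): chain pair `A₂·Λ₀ = (wordFrame A₁ κ)·Λ₀`, `|κ| ≥ 2`,
slot `u₁` IN the first mirror plane with `⟪A₁u₁, e₃⟫ ≥ 13/25`; modulo `ExactOnly`(C12-55) and `StarPairFar`. -/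
theorem genericWallFloorAtCharge_word_of_inner_ge
    {s₀ : EuclideanSpace ℝ (Fin 3)} (hs₀ : s₀ ∈ fccSlots)
    (hcert : ExactOnly 0 (fccSlots.filter fun w => 0 < ⟪w, s₀⟫_ℝ)) (hfar : StarPairFar)
    (A₁ : EuclideanSpace ℝ (Fin 3) ≃ₗᵢ[ℝ] EuclideanSpace ℝ (Fin 3)) (t₁ : EuclideanSpace ℝ (Fin 3))
    (A₂ : EuclideanSpace ℝ (Fin 3) ≃ₗᵢ[ℝ] EuclideanSpace ℝ (Fin 3)) (t₂ : EuclideanSpace ℝ (Fin 3))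
    {u₁ : EuclideanSpace ℝ (Fin 3)} (hu₁ : u₁ ∈ fccSlots)
    (hup : (13 / 25 : ℝ) ≤ ⟪A₁ u₁, EuclideanSpace.single (2 : Fin 3) (1 : ℝ)⟫_ℝ)
    (κ : List (EuclideanSpace ℝ (Fin 3)))
    (hκl : ∀ μ ∈ κ, ‖μ‖ = 1 ∧
      ∀ w ∈ fccSlots, ⟪w, μ⟫_ℝ = 0 ∨ ⟪w, μ⟫_ℝ = Real.sqrt (2 / 3) ∨ ⟪w, μ⟫_ℝ = -Real.sqrt (2 / 3))
    (hκc : List.IsChain (fun μ μ' => ⟪μ, μ'⟫_ℝ = 1 / 3 ∨ ⟪μ, μ'⟫_ℝ = -1 / 3) κ) (hκ2 : 2 ≤ κ.length)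
    (hA₂ : A₂ '' fccStacking 1 (Real.sqrt (2 / 3)) = (wordFrame A₁ κ) '' fccStacking 1 (Real.sqrt (2 / 3)))
    (hfirst : ∀ μ, κ.getLast? = some μ → ⟪u₁, μ⟫_ℝ = 0) :
    GenericWallFloorAtCharge (Real.sqrt 2 * ⟪A₁ u₁, EuclideanSpace.single (2 : Fin 3) (1 : ℝ)⟫_ℝ / 2) A₁ t₁ A₂ t₂ := by
  obtain ⟨z, hz, hze, hsteep⟩ := exists_tilt_vertical
    (by rw [LinearIsometryEquiv.norm_map, norm_eq_one_of_mem_fccSlots hu₁]) hup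
  have habs : |⟪A₁ u₁, EuclideanSpace.single (2 : Fin 3) (1 : ℝ)⟫_ℝ| = ⟪A₁ u₁, EuclideanSpace.single (2 : Fin 3) (1 : ℝ)⟫_ℝ :=
    abs_of_nonneg (by linarith)
  have h := genericWallFloorAtCharge_word_tilt_of_far hs₀ hcert hfar A₁ t₁ A₂ t₂ hz hze hu₁ hsteep κ hκl hκc hκ2 hA₂ hfirst
  rw [habs] at h
  exact h

/-- The charge of `genericWallFloorAtCharge_word_of_inner_ge` is at least `0.367`:
`(√2/2)·⟪A₁u₁, e₃⟫ ≥ (√2/2)(13/25) > 11/30`. -/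
theorem charge_of_inner_ge_lower {c : ℝ} (hc : (13 / 25 : ℝ) ≤ c) : (11 / 30 : ℝ) ≤ Real.sqrt 2 * c / 2 := by
  have hsq2 : Real.sqrt 2 ^ 2 = 2 := Real.sq_sqrt (by norm_num)
  have hsq0 : 0 ≤ Real.sqrt 2 := Real.sqrt_nonneg 2
  have ht : (1.41421 : ℝ) ≤ Real.sqrt 2 := by nlinarith
  nlinarith

end Summit.Ventures.Crystal3D.Theorems

end
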